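import Mathlib.MeasureTheory.Integral.Prod
import Mathlib.MeasureTheory.Function.LpSpace.Indicator
import Literature.Analysis.OperatorTheory.IntegralOperatorHilbertSchmidt
import Literature.Analysis.OperatorTheory.SupNormCompactOperator
import Literature.Analysis.OperatorTheory.PositivityImproving
import HarnessLib

/-!
# Integral operators with bounded, symmetric, strictly positive kernels on a finite measure space
# are compact, self-adjoint and positivity improving — PROVED

Topic `Literature/Analysis/OperatorTheory`; companion of `IntegralOperatorHilbertSchmidt.lean`
(Hilbert–Schmidt identity for bounded kernels on finite measure spaces), `SupNormCompactOperator.lean`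
(sup-norm bound ⇒ compact) and `PositivityImproving.lean` (Reed–Simon XIII.43). It assembles, for a
REAL kernel `K : X → X → ℝ` on a finite measure space `(X, μ)`, strongly measurable and bounded
(`‖K x y‖ ≤ C`), the TRANSFER OPERATOR `(Aφ)(x) = ∫ K(x, y) φ(y) dμ(y)` on the real Hilbert space
`Lp ℝ 2 μ` and its three structural properties — the input of the Perron–Frobenius–Jentzsch theory
(`PositivityImproving.lean`, `PositivityImprovingSpectralGap.lean`) used by transfer-operator proofs
for one-dimensional lattice models with a finite a priori measure (e.g. `ρ(dq) = e^{-U(q)/T} dq` and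
`K(a, b) = e^{-V(b-a)/T}` for a pinned nearest-neighbour chain). Everything is PROVED; NO definition
is introduced: the operator is delivered by the existence statement `exists_kernelOp` and every
property is stated for ANY bounded operator `A` agreeing a.e. with the kernel formula
(`hA : ∀ φ, A φ =ᵐ[μ] fun x => ∫ y, K x y * φ y ∂μ`), so that users may also apply them to operators
built otherwise.

* `integral_abs_le_sqrt_mul_norm` — `∫ |φ| dμ ≤ √μ(X) ‖φ‖₂` (Cauchy–Schwarz against `1`);
* `integrable_kernel_mul_coeFn`, `abs_integral_kernel_mul_le` — `|∫ K(x,y)φ(y)| ≤ C √μ(X) ‖φ‖₂`;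
* `exists_kernelOp` — existence of the bounded operator with the a.e. kernel formula
  (`LinearMap.mkContinuousOfExistsBound` on `φ ↦ toLp (x ↦ ∫ K(x,y)φ(y))`, tree
  `memLp_two_integral_kernel_mul`);
* `inner_kernelOp_eq_integral` — `⟪ψ, Aφ⟫ = ∫ ψ(x) ∫ K(x,y) φ(y)`; `integrable_mul_kernel_mul`;
* `isSelfAdjoint_kernelOp` — symmetric kernel ⇒ self-adjoint (Fubini, `integral_integral_swap`);
* `isCompactOperator_kernelOp` — bounded kernel ⇒ compact (tree `isCompactOperator_of_eLpNorm_top_le`);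
* `isPositivityImproving_kernelOp` — strictly positive kernel ⇒ positivity improving
  (`integral_pos_iff_support_of_nonneg_ae`), `kernelOp_ne_zero` (`μ ≠ 0`);
* `memLp_kernel_section`, `norm_kernel_section_le` — the sections `k_u = K(u, ·) ∈ L²`,
  `‖k_u‖ ≤ C √μ(X)` uniformly in `u`;
* `exists_transferOperator` — the package: `∃ A`, kernel formula ∧ self-adjoint ∧ compact ∧
  positivity improving ∧ `A ≠ 0`.

Sources: Reed–Simon I, §VI.6 (Hilbert–Schmidt integral operators, Thm VI.23) [`ReedSimonI1980`];
Reed–Simon IV, §XIII.12 (positivity improving integral operators with strictly positive kernels,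
Example 3 after Thm XIII.44) [`ReedSimonIV1978`]. Tree search: `L2KernelOperator.lean` treats
continuous compactly supported COMPLEX kernels on Lebesgue measure (`NiceKernel`, `kernelOp`), not
reusable here (real scalars, finite abstract measure space, no continuity).
-/

noncomputable section

open MeasureTheory Set Filter Function
open scoped RealInnerProductSpace ENNReal

namespace Literature.Analysis.OperatorTheory

variable {X : Type*} [MeasurableSpace X] {μ : Measure X} [IsFiniteMeasure μ]

/-! ### `L¹ ≤ L²` on a finite measure space -/

/-- Cauchy–Schwarz against the constant `1`: `∫ |φ| dμ ≤ √μ(X) ‖φ‖₂` for `φ ∈ L²` of a finite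
measure. [folklore] -/
theorem integral_abs_le_sqrt_mul_norm (φ : Lp ℝ 2 μ) :
    ∫ x, |φ x| ∂μ ≤ Real.sqrt (μ.real univ) * ‖φ‖ := by
  set one : Lp ℝ 2 μ := indicatorConstLp 2 MeasurableSet.univ (measure_ne_top μ univ) (1 : ℝ)
    with hone
  have h1 : ∫ x, |φ x| ∂μ = ⟪|φ|, one⟫ := by
    rw [inner_eq_integral]
    refine integral_congr_ae ?_
    filter_upwards [Lp.coeFn_abs φ, indicatorConstLp_coeFn (p := 2) (hs := MeasurableSet.univ)
      (hμs := measure_ne_top μ univ) (c := (1 : ℝ))] with x hx h1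
    rw [← hone] at h1
    rw [hx, h1, indicator_of_mem (mem_univ x), mul_one]
  have h2 : ‖one‖ = Real.sqrt (μ.real univ) := by
    rw [hone, norm_indicatorConstLp two_ne_zero ENNReal.ofNat_ne_top, norm_one, one_mul,
      Real.sqrt_eq_rpow, ENNReal.toReal_ofNat]
  rw [h1]
  calc ⟪|φ|, one⟫ ≤ ‖|φ|‖ * ‖one‖ := real_inner_le_norm _ _
    _ = Real.sqrt (μ.real univ) * ‖φ‖ := by rw [norm_abs_eq_norm, h2, mul_comm]

/-! ### The integral operator of a bounded kernel on `L²` of a finite measure -/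

section Kernel

variable {K : X → X → ℝ} {C : ℝ}

/-- `y ↦ K(x, y) φ(y)` is integrable for a bounded measurable kernel and `φ ∈ L²` (finite
measure: `L² ⊆ L¹`). [folklore] -/
theorem integrable_kernel_mul_coeFn (hK : StronglyMeasurable (uncurry K)) (hC : ∀ x y, ‖K x y‖ ≤ C)
    (φ : Lp ℝ 2 μ) (x : X) : Integrable (fun y => K x y * φ y) μ :=
  ((Lp.memLp φ).integrable one_le_two).bdd_mul (hK.of_uncurry_left (x := x)).aestronglyMeasurable
    (Eventually.of_forall fun y => hC x y)

/-- The sup-norm bound `|∫ K(x,y) φ(y) dμ(y)| ≤ C √μ(X) ‖φ‖₂`. [folklore] -/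
theorem abs_integral_kernel_mul_le (hC : ∀ x y, ‖K x y‖ ≤ C) (hC0 : 0 ≤ C) (φ : Lp ℝ 2 μ)
    (x : X) : |∫ y, K x y * φ y ∂μ| ≤ C * Real.sqrt (μ.real univ) * ‖φ‖ := by
  have h := norm_integral_kernel_mul_le (𝕜 := ℝ) hC φ x
  rw [Real.norm_eq_abs] at h
  refine h.trans ?_
  rw [mul_assoc]
  exact mul_le_mul_of_nonneg_left (integral_abs_le_sqrt_mul_norm φ) hC0

/-- **The integral operator of a bounded measurable kernel on `L²` of a finite measure space.**
There is a bounded operator `A` on `L²(X, μ)` with `(Aφ)(x) = ∫ K(x, y) φ(y) dμ(y)` for a.e. `x`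
(an existence statement, so that no definition is introduced; `A` is unique by `Lp.ext`).
[folklore] -/
theorem exists_kernelOp (hK : StronglyMeasurable (uncurry K)) (hC : ∀ x y, ‖K x y‖ ≤ C) :
    ∃ A : Lp ℝ 2 μ →L[ℝ] Lp ℝ 2 μ,
      ∀ φ : Lp ℝ 2 μ, (A φ : X → ℝ) =ᵐ[μ] fun x => ∫ y, K x y * φ y ∂μ := by
  set C' := max C 0 with hC'def
  have hC' : ∀ x y, ‖K x y‖ ≤ C' := fun x y => (hC x y).trans (le_max_left _ _)
  have hC'0 : 0 ≤ C' := le_max_right _ _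
  set F : Lp ℝ 2 μ → X → ℝ := fun φ x => ∫ y, K x y * φ y ∂μ with hF
  have hmem : ∀ φ, MemLp (F φ) 2 μ := fun φ => memLp_two_integral_kernel_mul hK hC φ
  have hint := fun φ x => integrable_kernel_mul_coeFn (μ := μ) hK hC φ x
  set L : Lp ℝ 2 μ →ₗ[ℝ] Lp ℝ 2 μ :=
    { toFun := fun φ => (hmem φ).toLp (F φ)
      map_add' := fun φ ψ => by
        rw [← MemLp.toLp_add (hmem φ) (hmem ψ), MemLp.toLp_eq_toLp_iff]
        refine Eventually.of_forall fun x => ?_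
        change F (φ + ψ) x = F φ x + F ψ x
        simp only [hF]
        rw [← integral_add (hint φ x) (hint ψ x)]
        refine integral_congr_ae ?_
        filter_upwards [Lp.coeFn_add φ ψ] with y hy
        rw [hy, Pi.add_apply, mul_add]
      map_smul' := fun c φ => by
        rw [RingHom.id_apply, ← MemLp.toLp_const_smul, MemLp.toLp_eq_toLp_iff]
        refine Eventually.of_forall fun x => ?_
        change F (c • φ) x = c • F φ x
        simp only [hF]
        rw [smul_eq_mul, ← integral_const_mul]
        refine integral_congr_ae ?_
        filter_upwards [Lp.coeFn_smul c φ] with y hy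
        rw [hy, Pi.smul_apply, smul_eq_mul]
        ring } with hL
  have hLapply : ∀ φ, L φ = (hmem φ).toLp (F φ) := fun φ => rfl
  set M : ℝ := (measureUnivNNReal μ : ℝ) ^ (2 : ℝ≥0∞).toReal⁻¹ * (C' * Real.sqrt (μ.real univ))
    with hM
  have hbound : ∀ φ, ‖L φ‖ ≤ M * ‖φ‖ := by
    intro φ
    have h1 : ∀ᵐ x ∂μ, ‖(L φ : X → ℝ) x‖ ≤ C' * Real.sqrt (μ.real univ) * ‖φ‖ := by
      filter_upwards [(hmem φ).coeFn_toLp] with x hx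
      rw [hLapply, hx, Real.norm_eq_abs]
      exact abs_integral_kernel_mul_le hC' hC'0 φ x
    have h2 := Lp.norm_le_of_ae_bound (by positivity) h1
    calc ‖L φ‖ ≤ (measureUnivNNReal μ : ℝ) ^ (2 : ℝ≥0∞).toReal⁻¹ *
          (C' * Real.sqrt (μ.real univ) * ‖φ‖) := h2
      _ = M * ‖φ‖ := by rw [hM]; ring
  refine ⟨L.mkContinuousOfExistsBound ⟨M, hbound⟩, fun φ => ?_⟩
  rw [LinearMap.mkContinuousOfExistsBound_apply, hLapply]
  exact (hmem φ).coeFn_toLp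

/-! ### Properties of an operator given by a kernel a.e. -/

variable {A : Lp ℝ 2 μ →L[ℝ] Lp ℝ 2 μ}

omit [IsFiniteMeasure μ] in
/-- `⟪ψ, Aφ⟫ = ∫ ψ(x) (∫ K(x,y) φ(y) dμ(y)) dμ(x)`. [folklore] -/
theorem inner_kernelOp_eq_integral (hA : ∀ φ : Lp ℝ 2 μ, (A φ : X → ℝ) =ᵐ[μ] fun x => ∫ y, K x y * φ y ∂μ)
    (ψ φ : Lp ℝ 2 μ) : ⟪ψ, A φ⟫ = ∫ x, ψ x * ∫ y, K x y * φ y ∂μ ∂μ := by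
  rw [inner_eq_integral]
  refine integral_congr_ae ?_
  filter_upwards [hA φ] with x hx
  rw [hx]

/-- The double integrand `ψ(x) K(x,y) φ(y)` is integrable on `μ ⊗ μ`. [folklore] -/
theorem integrable_mul_kernel_mul (hK : StronglyMeasurable (uncurry K)) (hC : ∀ x y, ‖K x y‖ ≤ C)
    (ψ φ : Lp ℝ 2 μ) : Integrable (fun z : X × X => ψ z.1 * (K z.1 z.2 * φ z.2)) (μ.prod μ) := by
  have h1 : Integrable (fun z : X × X => ψ z.1 * φ z.2) (μ.prod μ) :=
    ((Lp.memLp ψ).integrable one_le_two).mul_prod ((Lp.memLp φ).integrable one_le_two)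
  have h2 : Integrable (fun z : X × X => uncurry K z * (ψ z.1 * φ z.2)) (μ.prod μ) :=
    h1.bdd_mul hK.aestronglyMeasurable (Eventually.of_forall fun z => hC z.1 z.2)
  refine h2.congr (Eventually.of_forall fun z => ?_)
  simp only [uncurry]
  ring

/-- **Self-adjointness**: a symmetric kernel gives a self-adjoint operator (Fubini). [folklore] -/
theorem isSelfAdjoint_kernelOp (hK : StronglyMeasurable (uncurry K)) (hC : ∀ x y, ‖K x y‖ ≤ C)
    (hsymm : ∀ x y, K x y = K y x)
    (hA : ∀ φ : Lp ℝ 2 μ, (A φ : X → ℝ) =ᵐ[μ] fun x => ∫ y, K x y * φ y ∂μ) : IsSelfAdjoint A := by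
  rw [ContinuousLinearMap.isSelfAdjoint_iff_isSymmetric]
  intro φ ψ
  change ⟪A φ, ψ⟫ = ⟪φ, A ψ⟫
  rw [real_inner_comm, inner_kernelOp_eq_integral hA, inner_kernelOp_eq_integral hA]
  -- `∫ ψ x ∫ K x y φ y = ∫ φ x ∫ K x y ψ y`
  have h1 : ∫ x, ψ x * ∫ y, K x y * φ y ∂μ ∂μ = ∫ x, ∫ y, ψ x * (K x y * φ y) ∂μ ∂μ := by
    refine integral_congr_ae (Eventually.of_forall fun x => ?_)
    exact (integral_const_mul (ψ x) _).symm
  have h2 : ∫ x, φ x * ∫ y, K x y * ψ y ∂μ ∂μ = ∫ x, ∫ y, φ x * (K x y * ψ y) ∂μ ∂μ := by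
    refine integral_congr_ae (Eventually.of_forall fun x => ?_)
    exact (integral_const_mul (φ x) _).symm
  rw [h1, h2, integral_integral_swap (integrable_mul_kernel_mul hK hC ψ φ)]
  refine integral_congr_ae (Eventually.of_forall fun y => ?_)
  refine integral_congr_ae (Eventually.of_forall fun x => ?_)
  dsimp only
  rw [hsymm x y]
  ring

/-- **Compactness**: a bounded kernel on a finite measure space gives a compact operator (sup-norm
bound `‖Aφ‖_∞ ≤ C √μ(X) ‖φ‖₂` and Getz–Hahn's Lemma 9.3.2 form
`isCompactOperator_of_eLpNorm_top_le`; equivalently: Hilbert–Schmidt). [folklore] -/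
theorem isCompactOperator_kernelOp (hC : ∀ x y, ‖K x y‖ ≤ C) (hC0 : 0 ≤ C)
    (hA : ∀ φ : Lp ℝ 2 μ, (A φ : X → ℝ) =ᵐ[μ] fun x => ∫ y, K x y * φ y ∂μ) :
    IsCompactOperator A := by
  refine isCompactOperator_of_eLpNorm_top_le A (C := C * Real.sqrt (μ.real univ))
    (by positivity) fun φ => ?_
  rw [eLpNorm_exponent_top]
  refine eLpNormEssSup_le_of_ae_bound ?_
  filter_upwards [hA φ] with x hx
  rw [hx, Real.norm_eq_abs]
  exact (abs_integral_kernel_mul_le hC hC0 φ x).trans (le_of_eq (by ring))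

/-- **Positivity improvement**: a strictly positive kernel gives a positivity improving operator —
for `φ ≥ 0`, `φ ≠ 0` the integral `∫ K(x,y) φ(y) dμ(y)` is strictly positive for EVERY `x`.
[folklore] -/
theorem isPositivityImproving_kernelOp (hK : StronglyMeasurable (uncurry K))
    (hC : ∀ x y, ‖K x y‖ ≤ C) (hpos : ∀ x y, 0 < K x y)
    (hA : ∀ φ : Lp ℝ 2 μ, (A φ : X → ℝ) =ᵐ[μ] fun x => ∫ y, K x y * φ y ∂μ) :
    IsPositivityImproving A := by
  intro φ hφ
  have hφ0 : 0 ≤ᵐ[μ] (φ : X → ℝ) := (Lp.coeFn_nonneg φ).2 hφ.1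
  -- the support of `φ` has positive measure
  have hsupp : 0 < μ (support (φ : X → ℝ)) := by
    rw [pos_iff_ne_zero]
    intro h0
    refine hφ.2 (Lp.eq_zero_iff_ae_eq_zero.2 ?_)
    have : ∀ᵐ x ∂μ, x ∉ support (φ : X → ℝ) := measure_eq_zero_iff_ae_notMem.1 h0
    filter_upwards [this] with x hx
    simpa [mem_support] using hx
  have hall : ∀ x, 0 < ∫ y, K x y * φ y ∂μ := by
    intro x
    have hnn : 0 ≤ᵐ[μ] fun y => K x y * φ y := by
      filter_upwards [hφ0] with y hy using mul_nonneg (hpos x y).le hy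
    rw [integral_pos_iff_support_of_nonneg_ae hnn (integrable_kernel_mul_coeFn hK hC φ x)]
    have hs : support (fun y => K x y * φ y) = support (φ : X → ℝ) := by
      ext y
      simp only [mem_support, ne_eq, mul_eq_zero, (hpos x y).ne', false_or]
    rwa [hs]
  unfold IsStrictlyPositiveFun
  filter_upwards [hA φ] with x hx
  rw [hx]
  exact hall x

/-- A strictly positive kernel gives a NONZERO operator as soon as `μ ≠ 0`. [folklore] -/
theorem kernelOp_ne_zero (hK : StronglyMeasurable (uncurry K)) (hC : ∀ x y, ‖K x y‖ ≤ C)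
    (hpos : ∀ x y, 0 < K x y) (hμ : μ ≠ 0)
    (hA : ∀ φ : Lp ℝ 2 μ, (A φ : X → ℝ) =ᵐ[μ] fun x => ∫ y, K x y * φ y ∂μ) : A ≠ 0 := by
  intro hA0
  set one : Lp ℝ 2 μ := indicatorConstLp 2 MeasurableSet.univ (measure_ne_top μ univ) (1 : ℝ)
    with hone
  have hone_pos : IsPositiveFun one := by
    refine ⟨(Lp.coeFn_nonneg one).1 ?_, fun h0 => ?_⟩
    · filter_upwards [indicatorConstLp_coeFn (p := 2) (hs := MeasurableSet.univ)
        (hμs := measure_ne_top μ univ) (c := (1 : ℝ))] with x hx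
      rw [← hone] at hx
      rw [hx, indicator_of_mem (mem_univ x)]
      exact zero_le_one
    · have h1 : ‖one‖ = 0 := by rw [h0, norm_zero]
      rw [hone, norm_indicatorConstLp two_ne_zero ENNReal.ofNat_ne_top, norm_one, one_mul] at h1
      have h2 : μ.real univ = 0 := (Real.rpow_eq_zero measureReal_nonneg (by simp)).1 h1
      exact hμ (Measure.measure_univ_eq_zero.1 ((measureReal_eq_zero_iff (measure_ne_top μ univ)).1 h2))
  have h := isPositivityImproving_kernelOp hK hC hpos hA one hone_pos
  rw [hA0, _root_.zero_apply] at h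
  have hfalse : ∀ᵐ x ∂μ, False := by
    filter_upwards [h, Lp.coeFn_zero (E := ℝ) (p := 2) (μ := μ)] with x hx h0
    rw [h0, Pi.zero_apply] at hx
    exact lt_irrefl 0 hx
  exact hμ (MeasureTheory.ae_eq_bot.1 (Filter.eventually_false_iff_eq_bot.1 hfalse))

/-! ### Kernel sections and the package -/

/-- The section `k_u = K(u, ·)` of a bounded measurable kernel is in `L²` of the finite measure.
[folklore] -/
theorem memLp_kernel_section (hK : StronglyMeasurable (uncurry K)) (hC : ∀ x y, ‖K x y‖ ≤ C)
    (u : X) : MemLp (K u) 2 μ :=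
  MemLp.of_bound (hK.of_uncurry_left (x := u)).aestronglyMeasurable C
    (Eventually.of_forall fun y => hC u y)

/-- `‖k_u‖₂ ≤ C √μ(X)`, uniformly in `u`. [folklore] -/
theorem norm_kernel_section_le (hK : StronglyMeasurable (uncurry K)) (hC : ∀ x y, ‖K x y‖ ≤ C)
    (hC0 : 0 ≤ C) (u : X) :
    ‖(memLp_kernel_section (μ := μ) hK hC u).toLp (K u)‖ ≤
      (measureUnivNNReal μ : ℝ) ^ (2 : ℝ≥0∞).toReal⁻¹ * C :=
  Lp.norm_le_of_ae_bound hC0 (by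
    filter_upwards [(memLp_kernel_section (μ := μ) hK hC u).coeFn_toLp] with y hy
    rw [hy]
    exact hC u y)

/-- `⟪ψ, k_u⟫ = ∫ ψ(y) K(u, y) dμ(y)`. [folklore] -/
theorem inner_kernel_section (hK : StronglyMeasurable (uncurry K)) (hC : ∀ x y, ‖K x y‖ ≤ C)
    (ψ : Lp ℝ 2 μ) (u : X) :
    ⟪ψ, (memLp_kernel_section (μ := μ) hK hC u).toLp (K u)⟫ = ∫ y, ψ y * K u y ∂μ := by
  rw [inner_eq_integral]
  refine integral_congr_ae ?_
  filter_upwards [(memLp_kernel_section (μ := μ) hK hC u).coeFn_toLp] with y hy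
  rw [hy]

/-- **The transfer operator of a bounded, symmetric, strictly positive kernel on a finite nonzero
measure space** is a nonzero compact self-adjoint positivity improving operator on the real `L²`:
the package consumed by `IsPositivityImproving.simple_top_eigenvalue` /
`IsPositivityImproving.exists_spectralGap` (Perron–Frobenius–Jentzsch). [folklore] -/
theorem exists_transferOperator (hK : StronglyMeasurable (uncurry K)) (hC : ∀ x y, ‖K x y‖ ≤ C)
    (hsymm : ∀ x y, K x y = K y x) (hpos : ∀ x y, 0 < K x y) (hμ : μ ≠ 0) :
    ∃ A : Lp ℝ 2 μ →L[ℝ] Lp ℝ 2 μ,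
      (∀ φ : Lp ℝ 2 μ, (A φ : X → ℝ) =ᵐ[μ] fun x => ∫ y, K x y * φ y ∂μ) ∧
      IsSelfAdjoint A ∧ IsCompactOperator A ∧ IsPositivityImproving A ∧ A ≠ 0 := by
  obtain ⟨A, hA⟩ := exists_kernelOp (μ := μ) hK hC
  have hC0 : 0 ≤ C := by
    have : μ univ ≠ 0 := fun h => hμ (Measure.measure_univ_eq_zero.1 h)
    obtain ⟨x, -⟩ := nonempty_of_measure_ne_zero this
    exact (norm_nonneg _).trans (hC x x)
  exact ⟨A, hA, isSelfAdjoint_kernelOp hK hC hsymm hA, isCompactOperator_kernelOp hC hC0 hA,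
    isPositivityImproving_kernelOp hK hC hpos hA, kernelOp_ne_zero hK hC hpos hμ hA⟩

end Kernel

end Literature.Analysis.OperatorTheory

end
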